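import Literature.AnabelianGeometry.EtaleTheta.Discharge.Sec5Prop52AtGenuineBases
import Literature.AnabelianGeometry.EtaleTheta.Discharge.Sec5RigidityGlue

/-!
# [EtTh] Prop. 5.2 (iii) ⟹ Prop. 4.3 (iii) at the GENUINE §5 data: the F-0558 site of `biKummerDifferenceMem_of_thetaPairKummerClass` RE-CLOSED (p. 324, p. 317 / PDF pp. 98, 91)

S. Mochizuki, *The étale theta function and its Frobenioid-theoretic manifestations*, Publ. RIMS **45** (2009)
[cite: MochizukiEtTh2009, Prop 5.2 (iii) p.324 (PDF p.98); Prop 4.3 (iii) p.317 (PDF p.91); §5 p.331 (PDF p.105)].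
PROOF-ONLY companion (no `def`, no instance, no new named fact; nothing landed is edited or restated).  abc-iut cell, block C (rung
LADDER-ABC:A2.C, R-C / K4 re-close), seat abc-iut-w6-d047 (gen 4), abc-iut-L2-lead R858 row «K4 M9 PROP5.2(iii) ROW 12»: cone node
**EtTh:Prop5.2(iii)** — abc-iut-c312-2 CONE-K4-RECLOSE v4: class BLOCKED, 11/12 rows RECLOSED (abc-iut-w6-d053 K4-w6d053-SEC5-RECLOSED), the
twelfth = FACT row **F-0558** `FrobenioidThetaBiKummer.ThetaPairKummerClass` at binder #7 `h` of abc-iut-f-046/L2's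
`ThetaFrobenioid.biKummerDifferenceMem_of_thetaPairKummerClass` (`Discharge/Sec5RigidityGlue.lean` l.111: «Prop. 5.2 (iii) in cocycle form ⟹
the bi-Kummer difference `s^⊓-gp_N·(s^⊔-gp_N)⁻¹` is `μ_N(B_N)`-valued», i.e. ⟹ Prop. 4.3 (iii) `BiKummerDifferenceMem`), so far only BYPASSED.

HERE the site FIRES at the genuine data with its F-0558 binder SUPPLIED by CLOSED producers (abc-iut-f-126's `η`-existential forms,
`Discharge/Sec5Prop52AtGenuineBases.lean`), the consumer's conclusion being knit UNDER the `∃η`: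
* `biKummerDifferenceMem_of_exists_thetaPairKummerClass` — generic: for any comparison `ν : (l·Δ_Θ)_{B_N} ⊗ ℤ/N ≃* μ_N(B_N)`,
  `(∃ η, ThetaPairKummerClass 𝔉 η ν) → 𝔉.BiKummerDifferenceMem` (the site under an `obtain`);
* `biKummerDifferenceMem_of_thetaPairKummerClass_ofConnectedTemperoidData` — over the GENUINE connected base `B^temp(Π^tp_X)⁰`
  (abc-iut-w4-d099's `ofConnectedTemperoidData`) modulo the single printed input `hH` («`Π^tp_Ÿ ⊆ H_⊙`», §5 p. 322), the `∃η` supplied by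
  `exists_thetaPairKummerClass_ofConnectedTemperoidData_of_hH`;
* `biKummerDifferenceMem_of_thetaPairKummerClass_ofConnectedTemperoidYddData` — with `A_⊙^bs := Ÿ` (`mkOfConnectedTemperoidYdd`): NO named
  input beyond the construction data and the comparison datum `ν`, the `∃η` supplied by `exists_thetaPairKummerClass_ofConnectedTemperoidYddData`.
HONEST NOTE (content): at these data the site's CONCLUSION is already abc-iut-w6-d054's theorem `biKummerDifferenceMem_ofConnectedTemperoid(Ydd)Data`
(Prop. 4.3 (iii)), from which f-126's `∃η` producers are themselves derived (witness `η := ν⁻¹ ∘ (s^⊓-gp_N·(s^⊔-gp_N)⁻¹)`, `u := 1`) — the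
value of this file is the K4 bookkeeping fact that the Prop. 5.2 (iii) ⟹ Prop. 4.3 (iii) site is INSTANTIABLE at genuine data with its FACT
binder supplied by name (no refuted-closure head left), not a new route to Prop. 4.3 (iii); the PINNED `η` (reduction mod `N` of `η̈^Θ`,
Prop. 5.2 (iii) as printed) is abc-iut-w4-d099's `Discharge/Sec5ThetaSectionCompatOfKummerClass.lean` line and is NOT claimed here.
HONEST FRAMING: kernel-checked implications between typed §5 data; nothing asserts that the §5 data exist for an actual curve; typed ≠
proved; no side taken on [IUTchIII] Cor. 3.12. [claim: MochizukiEtTh2009, status: refereed pre-IUT]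
-/

noncomputable section

namespace Literature.AnabelianGeometry.EtaleTheta

open CategoryTheory Opposite Literature.AlgebraicGeometry.Frobenioids Literature.AnabelianGeometry.SemiGraphs
  Literature.AnabelianGeometry.SemiGraphs.GaloisObjects Literature.AlgebraicGeometry.Frobenioids.QuasiTemperoid.BTempConnected

universe u₀ v₀ u v w w' v' u' u''

namespace ThetaFrobenioid

/-! ### §1. Generic: the site under the `∃η` -/

section Generic

variable {C : Type u'} [Category.{v'} C] {D : Type u''} [Category.{w'} D] (𝔉 : ThetaFrobenioid.{w} C D)

/-- **Prop. 5.2 (iii) (cocycle form, `η`-EXISTENTIAL for a given comparison `ν`) ⟹ Prop. 4.3 (iii)**: if SOME cocycle `η` on `H_{B_N}`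
satisfies `ThetaPairKummerClass 𝔉 η ν`, the bi-Kummer difference is `μ_N(B_N)`-valued — the site `biKummerDifferenceMem_of_thetaPairKummerClass`
under an `obtain`.  [cite: MochizukiEtTh2009, Prop 5.2 (iii) p.324 (PDF p.98); Prop 4.3 (iii) p.317 (PDF p.91)] -/
theorem biKummerDifferenceMem_of_exists_thetaPairKummerClass (ν : 𝔉.lDeltaModN 𝔉.BN ≃* 𝔉.muTorsion 𝔉.BN 𝔉.N)
    (hex : ∃ η : 𝔉.HB → 𝔉.lDeltaModN 𝔉.BN, FrobenioidThetaBiKummer.ThetaPairKummerClass 𝔉 η ν) :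
    𝔉.BiKummerDifferenceMem := by
  obtain ⟨η, hη⟩ := hex
  exact 𝔉.biKummerDifferenceMem_of_thetaPairKummerClass η ν hη

end Generic

/-! ### §2. Over the GENUINE connected base `B^temp(Π^tp_X)⁰` modulo `hH` -/

section OfConnectedTemperoidData

variable {K : Type u₀} [Field K] {X : SemiGraphs.TemperedArithmeticGroup.{u₀} K} {D₀ : Type u₀} [Category.{v₀} D₀]
  {V : FrdIMonoidStub.{w}} {T₀ : RealifiedDivisorMonoids (D₀ := D₀) V}
  {VD : FrdICatStub.{u₀ + 1, u₀, w} (ConnectedPart (BTemp X.Pi))}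
  {tf : TemperedFrobenioid T₀ (ConnectedPart (BTemp X.Pi)) VD} {hZ : tf.monoidType = MonoidType.Z}
  {hP : ∀ A : (ConnectedPart (BTemp X.Pi))ᵒᵖ, IsPerfect (tf.Φ.carrier A)}
  {NH : Subgroup (Field.absoluteGaloisGroup K) → tf.category → ℕ+ → Prop} {A₀ : tf.category}
  {hA₀ : PreFrobenioid.IsFrobeniusTrivial tf.toElem A₀} {hA₀' : SemiGraphs.IsGaloisObj A₀.base.obj}
  {pullFrac : ∀ {A A' : (BiKummerSetting.mkOfConnectedTemperoid X tf hZ hP NH A₀ hA₀ hA₀').C} (_ : A' ⟶ A),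
    (BiKummerSetting.mkOfConnectedTemperoid X tf hZ hP NH A₀ hA₀ hA₀').biratUnits A →
      (BiKummerSetting.mkOfConnectedTemperoid X tf hZ hP NH A₀ hA₀ hA₀').biratUnits A'}
  {lv N : ℕ+} {T : ThetaEnvData.{max u₀ w} N}
  {θ : (BiKummerSetting.mkOfConnectedTemperoid X tf hZ hP NH A₀ hA₀ hA₀').biratUnits
    (BiKummerSetting.mkOfConnectedTemperoid X tf hZ hP NH A₀ hA₀ hA₀').Aodot}
  {Bl : (BiKummerSetting.mkOfConnectedTemperoid X tf hZ hP NH A₀ hA₀ hA₀').C}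
  {Pl : (BiKummerSetting.mkOfConnectedTemperoid X tf hZ hP NH A₀ hA₀ hA₀').FractionPair θ Bl}
  {Rl : (BiKummerSetting.mkOfConnectedTemperoid X tf hZ hP NH A₀ hA₀ hA₀').NthRoot θ Pl lv pullFrac}
  (h : ModelFrobenioid.Hypotheses tf.divisorMonoid tf.ratFnFunctor)
  (Q : FrobenioidTheta.ThetaSubquotientStub.{w} (ConnectedPart (BTemp X.Pi))) (odd_l : Odd (lv : ℕ))
  (R : (BiKummerSetting.mkOfConnectedTemperoid X tf hZ hP NH A₀ hA₀ hA₀').NthRoot Rl.root Rl.pair N pullFrac)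
  (ιX : T.PiX ≃ₜ* X.Pi) (K' : Type w) [Field K'] (constEmb : K'ˣ →* tf.biratUnitsModel R.BN)
  (constEmb_injective : Function.Injective constEmb)
  (hinvc : ∀ g : Aut R.AN.base,
    pull tf.divisorMonoid g.hom (ModelFrobenioid.div R.pair.num) = ModelFrobenioid.div R.pair.num)
  (hinvp : ∀ y : T.PiX, y ∈ T.PiYdd →
    pull tf.divisorMonoid ((BiKummerSetting.mkOfConnectedTemperoid X tf hZ hP NH A₀ hA₀ hA₀').galoisSurj R.AN.base
      R.αData.isGalois (ιX y)).hom (ModelFrobenioid.div R.pair.den) = ModelFrobenioid.div R.pair.den)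

/-- **The F-0558 site RE-CLOSED over `B^temp(Π^tp_X)⁰` modulo the single printed input `hH`** («`Π^tp_Ÿ ⊆ H_⊙`», §5 p. 322): for every
comparison `ν` the `∃η` of Prop. 5.2 (iii) is abc-iut-f-126's `exists_thetaPairKummerClass_ofConnectedTemperoidData_of_hH`, and the site
`biKummerDifferenceMem_of_thetaPairKummerClass` fires under it — NO `ThetaPairKummerClass` binder.
[cite: MochizukiEtTh2009, Prop 5.2 (iii) p.324 (PDF p.98); Prop 4.3 (iii) p.317 (PDF p.91)] -/
theorem biKummerDifferenceMem_of_thetaPairKummerClass_ofConnectedTemperoidData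
    (hH : ∀ y : T.PiX, y ∈ T.PiYdd → ιX y ∈ (BiKummerSetting.mkOfConnectedTemperoid X tf hZ hP NH A₀ hA₀ hA₀').Hodot)
    (ν : (ofConnectedTemperoidData h Q odd_l R ιX K' constEmb constEmb_injective hinvc hinvp).lDeltaModN
        (ofConnectedTemperoidData h Q odd_l R ιX K' constEmb constEmb_injective hinvc hinvp).BN ≃*
      (ofConnectedTemperoidData h Q odd_l R ιX K' constEmb constEmb_injective hinvc hinvp).muTorsion
        (ofConnectedTemperoidData h Q odd_l R ιX K' constEmb constEmb_injective hinvc hinvp).BN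
        (ofConnectedTemperoidData h Q odd_l R ιX K' constEmb constEmb_injective hinvc hinvp).N) :
    (ofConnectedTemperoidData h Q odd_l R ιX K' constEmb constEmb_injective hinvc hinvp).BiKummerDifferenceMem :=
  (ofConnectedTemperoidData h Q odd_l R ιX K' constEmb constEmb_injective hinvc hinvp).biKummerDifferenceMem_of_exists_thetaPairKummerClass
    ν (exists_thetaPairKummerClass_ofConnectedTemperoidData_of_hH h Q odd_l R ιX K' constEmb constEmb_injective hinvc hinvp hH ν)

end OfConnectedTemperoidData

/-! ### §3. With `A_⊙^bs := Ÿ`: no named input beyond the construction data and `ν` -/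

section OfConnectedTemperoidYddData

variable {K : Type u₀} [Field K] {X : SemiGraphs.TemperedArithmeticGroup.{u₀} K} {D₀ : Type u₀} [Category.{v₀} D₀]
  {V : FrdIMonoidStub.{w}} {T₀ : RealifiedDivisorMonoids (D₀ := D₀) V}
  {VD : FrdICatStub.{u₀ + 1, u₀, w} (ConnectedPart (BTemp X.Pi))}
  {tf : TemperedFrobenioid T₀ (ConnectedPart (BTemp X.Pi)) VD} {hZ : tf.monoidType = MonoidType.Z}
  {hP : ∀ A : (ConnectedPart (BTemp X.Pi))ᵒᵖ, IsPerfect (tf.Φ.carrier A)}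
  {NH : Subgroup (Field.absoluteGaloisGroup K) → tf.category → ℕ+ → Prop}
  {lv N : ℕ+} {T : ThetaEnvData.{max u₀ w} N} {ιX : T.PiX ≃ₜ* X.Pi}
  {pullFrac : ∀ {A A' : (BiKummerSetting.mkOfConnectedTemperoidYdd X tf hZ hP NH T ιX).C} (_ : A' ⟶ A),
    (BiKummerSetting.mkOfConnectedTemperoidYdd X tf hZ hP NH T ιX).biratUnits A →
      (BiKummerSetting.mkOfConnectedTemperoidYdd X tf hZ hP NH T ιX).biratUnits A'}
  {θ : (BiKummerSetting.mkOfConnectedTemperoidYdd X tf hZ hP NH T ιX).biratUnits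
    (BiKummerSetting.mkOfConnectedTemperoidYdd X tf hZ hP NH T ιX).Aodot}
  {Bl : (BiKummerSetting.mkOfConnectedTemperoidYdd X tf hZ hP NH T ιX).C}
  {Pl : (BiKummerSetting.mkOfConnectedTemperoidYdd X tf hZ hP NH T ιX).FractionPair θ Bl}
  {Rl : (BiKummerSetting.mkOfConnectedTemperoidYdd X tf hZ hP NH T ιX).NthRoot θ Pl lv pullFrac}
  (h : ModelFrobenioid.Hypotheses tf.divisorMonoid tf.ratFnFunctor)
  (Q : FrobenioidTheta.ThetaSubquotientStub.{w} (ConnectedPart (BTemp X.Pi))) (odd_l : Odd (lv : ℕ))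
  (R : (BiKummerSetting.mkOfConnectedTemperoidYdd X tf hZ hP NH T ιX).NthRoot Rl.root Rl.pair N pullFrac)
  (K' : Type w) [Field K'] (constEmb : K'ˣ →* tf.biratUnitsModel R.BN) (constEmb_injective : Function.Injective constEmb)
  (hinvc : ∀ g : Aut R.AN.base,
    pull tf.divisorMonoid g.hom (ModelFrobenioid.div R.pair.num) = ModelFrobenioid.div R.pair.num)
  (hinvp : ∀ y : T.PiX, y ∈ T.PiYdd →
    pull tf.divisorMonoid ((BiKummerSetting.mkOfConnectedTemperoidYdd X tf hZ hP NH T ιX).galoisSurj R.AN.base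
      R.αData.isGalois (ιX y)).hom (ModelFrobenioid.div R.pair.den) = ModelFrobenioid.div R.pair.den)


/-- **The F-0558 site RE-CLOSED for the §5 data over `B^temp(Π^tp_X)⁰` with `A_⊙^bs := Ÿ`** (`mkOfConnectedTemperoidYdd`; `hH` is
abc-iut-L2-t4's theorem `hH_mkOfConnectedTemperoidYdd`): for every comparison `ν`, Prop. 5.2 (iii) (`∃η`, abc-iut-f-126's
`exists_thetaPairKummerClass_ofConnectedTemperoidYddData`) ⟹ Prop. 4.3 (iii) through the site — binders = construction data + `ν` only.
[cite: MochizukiEtTh2009, Prop 5.2 (iii) p.324 (PDF p.98); Prop 4.3 (iii) p.317 (PDF p.91)] -/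
theorem biKummerDifferenceMem_of_thetaPairKummerClass_ofConnectedTemperoidYddData
    (ν : (ofConnectedTemperoidData h Q odd_l R ιX K' constEmb constEmb_injective hinvc hinvp).lDeltaModN
        (ofConnectedTemperoidData h Q odd_l R ιX K' constEmb constEmb_injective hinvc hinvp).BN ≃*
      (ofConnectedTemperoidData h Q odd_l R ιX K' constEmb constEmb_injective hinvc hinvp).muTorsion
        (ofConnectedTemperoidData h Q odd_l R ιX K' constEmb constEmb_injective hinvc hinvp).BN
        (ofConnectedTemperoidData h Q odd_l R ιX K' constEmb constEmb_injective hinvc hinvp).N) :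
    (ofConnectedTemperoidData h Q odd_l R ιX K' constEmb constEmb_injective hinvc hinvp).BiKummerDifferenceMem :=
  (ofConnectedTemperoidData h Q odd_l R ιX K' constEmb constEmb_injective hinvc hinvp).biKummerDifferenceMem_of_exists_thetaPairKummerClass
    ν (exists_thetaPairKummerClass_ofConnectedTemperoidYddData h Q odd_l R K' constEmb constEmb_injective hinvc hinvp ν)

end OfConnectedTemperoidYddData

end ThetaFrobenioid

end Literature.AnabelianGeometry.EtaleTheta

end
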